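import Mathlib.Algebra.MvPolynomial.CommRing
import Mathlib.Algebra.MvPolynomial.Monad
import Mathlib.Algebra.BigOperators.Group.Finset.Basic
import HarnessLib

/-!
# The composition law of the shape group with a `W`-coordinate (instrument, NOT a resolution theorem)

Engine 1 of the RESOLUTION OBSERVATORY toy model `W(f)` — CARVER-NOTES-eng1-g41 **T97, typed ingredient (i)** ("the composition law of the
shape group: extend T95 by the `W`-coordinate, `Λtot_{A∘B}(z) = Λtot_A(z) + Λtot_B(z + σ^s c_A)` and the cocycle `σM_B·Λtot_A` in the
`f`-coordinate"; RE-DERIVATION-eng1-g41 §3.7.5b (1)), as PURE ALGEBRA over an arbitrary commutative ring `R` (the engine's `R = k[σ]`, the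
powers of `σ` being absorbed into the data):

substitutions of `MvPolynomial ι R` of the SHAPE
  `z ↦ z + c_z` (`z ∈ Zs`, `c_z ∈ R` constant),  `W ↦ W + Λ_W(z)` (`W ∈ Ws`, `Λ_W ∈ R[Zs]`),
  `x ↦ x + Σ_{W ∈ Ws} m_{x,W}·W + Θ_x(z)` (every other slot; `Θ_x ∈ R[Zs]`; fixed slots have `m = Θ = 0`),
compose (`A ∘ B` = the algebra-map composite "apply `B`'s substitution, then `A`'s") according to
  `c_{A∘B} = c_A + c_B`, `m_{A∘B} = m_A + m_B`, `Λ_{A∘B} = Λ_A + τ_{c_A}Λ_B`, `Θ_{A∘B} = Θ_A + τ_{c_A}Θ_B + Σ_W m_{B,·,W}·Λ_{A,W}`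
(`τ_c` = translation `z ↦ z + c` on `R[Zs]`) — `Data.comp`, `shapeHom_comp`; powers `Data.pow` with the closed forms `pow_c = n•c`, `pow_m = n•m`,
`pow_Λ = Σ_{i<n} τ_{i•c} Λ` (the engine's `Λtot_{X^m}(z) = Σ_{i<m} Λtot_X(z + iσ^s c)`) and `shapeHom_pow`.

Polynomial substitutions [Lang2002, Ch. IV §1]; statements engine 1's, this generic packaging OURS.  Nothing here is about resolution of
singularities.
-/

namespace Literature.AlgebraicGeometry.Resolution.WeightedBlowup

namespace ShapeGroup

open MvPolynomial

variable {R : Type*} [CommRing R] {ι : Type*} [DecidableEq ι]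

/-! ## Polynomials in the `Z`-slots and their translations -/

/-- `q` involves only `Z`-slots (ours, bookkeeping). [cite: Lang2002, Ch. IV §1] -/
def OverZ (Zs : Finset ι) (q : MvPolynomial ι R) : Prop := q.vars ⊆ Zs

omit [DecidableEq ι] in
/-- Constants are over `Z` (ours, bookkeeping). [cite: Lang2002, Ch. IV §1] -/
theorem overZ_C (Zs : Finset ι) (r : R) : OverZ Zs (C r : MvPolynomial ι R) := by
  simp [OverZ, vars_C]

omit [DecidableEq ι] in
/-- `0` is over `Z` (ours, bookkeeping). [cite: Lang2002, Ch. IV §1] -/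
theorem overZ_zero (Zs : Finset ι) : OverZ Zs (0 : MvPolynomial ι R) := by
  simp [OverZ, vars_0]

/-- Sums stay over `Z` (ours, bookkeeping). [cite: Lang2002, Ch. IV §1] -/
theorem OverZ.add {Zs : Finset ι} {p q : MvPolynomial ι R} (hp : OverZ Zs p) (hq : OverZ Zs q) : OverZ Zs (p + q) :=
  fun _ hi => (Finset.mem_union.mp (vars_add_subset p q hi)).elim (fun h => hp h) (fun h => hq h)

/-- Products stay over `Z` (ours, bookkeeping). [cite: Lang2002, Ch. IV §1] -/
theorem OverZ.mul {Zs : Finset ι} {p q : MvPolynomial ι R} (hp : OverZ Zs p) (hq : OverZ Zs q) : OverZ Zs (p * q) :=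
  fun _ hi => (Finset.mem_union.mp (vars_mul p q hi)).elim (fun h => hp h) (fun h => hq h)

/-- Finite sums stay over `Z` (ours, bookkeeping). [cite: Lang2002, Ch. IV §1] -/
theorem OverZ.sum {Zs : Finset ι} {κ : Type*} (s : Finset κ) (F : κ → MvPolynomial ι R) (h : ∀ k ∈ s, OverZ Zs (F k)) :
    OverZ Zs (∑ k ∈ s, F k) :=
  Finset.sum_induction F (OverZ Zs) (fun _ _ => OverZ.add) (overZ_zero Zs) h

/-- The TRANSLATION `τ_c : z ↦ z + c_z` on the `Z`-slots, identity elsewhere (ours). [cite: Lang2002, Ch. IV §1] -/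
noncomputable def transl (Zs : Finset ι) (c : ι → R) : MvPolynomial ι R →ₐ[R] MvPolynomial ι R :=
  aeval fun z => if z ∈ Zs then X z + C (c z) else X z

/-- `τ_c` on a generator (ours, bookkeeping). [cite: Lang2002, Ch. IV §1] -/
@[simp] theorem transl_X (Zs : Finset ι) (c : ι → R) (x : ι) :
    transl Zs c (X x) = if x ∈ Zs then X x + C (c x) else X x := by
  simp [transl]

/-- `τ_0 = id` (ours, bookkeeping). [cite: Lang2002, Ch. IV §1] -/
theorem transl_zero (Zs : Finset ι) : transl Zs (0 : ι → R) = AlgHom.id R (MvPolynomial ι R) := by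
  refine MvPolynomial.algHom_ext fun x => ?_
  rw [transl_X, AlgHom.id_apply]
  split_ifs <;> simp

/-- `τ_c ∘ τ_{c'} = τ_{c + c'}` (ours): translations form an additive group. [cite: Lang2002, Ch. IV §1] -/
theorem transl_comp (Zs : Finset ι) (c c' : ι → R) : (transl Zs c).comp (transl Zs c') = transl Zs (c + c') := by
  refine MvPolynomial.algHom_ext fun x => ?_
  rw [AlgHom.comp_apply, transl_X, transl_X]
  split_ifs with hx
  · rw [map_add, transl_X, if_pos hx, MvPolynomial.algHom_C, MvPolynomial.algebraMap_eq, Pi.add_apply, C_add]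
    ring
  · rw [transl_X, if_neg hx]

/-- `τ_c (τ_{c'} q) = τ_{c + c'} q` (ours, pointwise form). [cite: Lang2002, Ch. IV §1] -/
theorem transl_transl (Zs : Finset ι) (c c' : ι → R) (q : MvPolynomial ι R) :
    transl Zs c (transl Zs c' q) = transl Zs (c + c') q := by
  rw [← AlgHom.comp_apply, transl_comp]

/-- Translations keep polynomials over `Z` over `Z` (ours, bookkeeping). [cite: Lang2002, Ch. IV §1] -/
theorem OverZ.transl {Zs : Finset ι} (c : ι → R) {q : MvPolynomial ι R} (hq : OverZ Zs q) : OverZ Zs (ShapeGroup.transl Zs c q) := by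
  rcases subsingleton_or_nontrivial R with hR | hR
  · intro i hi
    have h1 : (1 : MvPolynomial ι R) = 0 := by rw [← C_1, Subsingleton.elim (1 : R) 0, C_0]
    have h0 : ShapeGroup.transl Zs c q = 0 := by
      rw [← mul_one (ShapeGroup.transl Zs c q), h1, mul_zero]
    rw [h0, vars_0] at hi
    simp at hi
  · intro i hi
    rw [ShapeGroup.transl, aeval_eq_bind₁] at hi
    obtain ⟨j, hj, hij⟩ := Finset.mem_biUnion.mp (vars_bind₁ _ q hi)
    have hjZ : j ∈ Zs := hq hj
    rw [if_pos hjZ] at hij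
    rcases Finset.mem_union.mp (vars_add_subset _ _ hij) with h | h
    · rw [vars_X, Finset.mem_singleton] at h
      exact h ▸ hjZ
    · simp [vars_C] at h

/-! ## Shape data and the substitution it defines -/

/-- SHAPE DATA (ours): `Z`-translations `c`, `W`-shifts `Λ` (polynomials in the `Z`-slots), the linear `W`-part `m x W` and the `Z`-part
`Θ x` of the shift of every other slot `x`. [cite: Lang2002, Ch. IV §1] -/
structure Data (ι : Type*) (R : Type*) [CommSemiring R] where
  /-- `z ↦ z + c z` on `Z`-slots -/
  c : ι → R
  /-- `W ↦ W + Λ W` on `W`-slots -/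
  Λ : ι → MvPolynomial ι R
  /-- the linear `W`-part of the shift of `x`: `Σ_W m x W · W` -/
  m : ι → ι → R
  /-- the `Z`-part of the shift of `x` -/
  Θ : ι → MvPolynomial ι R

/-- The zero data (the identity substitution; ours). [cite: Lang2002, Ch. IV §1] -/
protected noncomputable def Data.zero : Data ι R := ⟨0, fun _ => 0, 0, fun _ => 0⟩

/-- **The composition law** (ours; engine 1's (1) of §3.7.5b): `c_A + c_B`, `Λ_A + τ_{c_A}Λ_B`, `m_A + m_B`,
`Θ_A + τ_{c_A}Θ_B + Σ_W m_{B,x,W}·Λ_{A,W}` (the cocycle). [cite: Lang2002, Ch. IV §1] -/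
noncomputable def Data.comp (Zs Ws : Finset ι) (A B : Data ι R) : Data ι R where
  c := A.c + B.c
  Λ := fun W => A.Λ W + ShapeGroup.transl Zs A.c (B.Λ W)
  m := A.m + B.m
  Θ := fun x => A.Θ x + ShapeGroup.transl Zs A.c (B.Θ x) + ∑ W ∈ Ws, C (B.m x W) * A.Λ W

/-- Powers `D^{n}` by `D^{n+1} = D ∘ D^{n}` (ours). [cite: Lang2002, Ch. IV §1] -/
noncomputable def Data.pow (Zs Ws : Finset ι) (D : Data ι R) : ℕ → Data ι R
  | 0 => Data.zero
  | n + 1 => D.comp Zs Ws (Data.pow Zs Ws D n)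

/-- The data is OVER `Z`: every `Λ W` (`W ∈ Ws`) and every `Θ x` is a polynomial in the `Z`-slots (ours). [cite: Lang2002, Ch. IV §1] -/
structure Data.IsOverZ (Zs Ws : Finset ι) (D : Data ι R) : Prop where
  overΛ : ∀ W ∈ Ws, OverZ Zs (D.Λ W)
  overΘ : ∀ x, OverZ Zs (D.Θ x)

/-- The SHAPE SUBSTITUTION of the data (ours): `z ↦ z + c_z`, `W ↦ W + Λ_W`, `x ↦ x + Σ_W m_{x,W} W + Θ_x`. [cite: Lang2002, Ch. IV §1] -/
noncomputable def shapeHom (Zs Ws : Finset ι) (D : Data ι R) : MvPolynomial ι R →ₐ[R] MvPolynomial ι R :=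
  aeval fun x => if x ∈ Zs then X x + C (D.c x) else if x ∈ Ws then X x + D.Λ x else X x + (∑ W ∈ Ws, C (D.m x W) * X W) + D.Θ x

section Laws

variable (Zs Ws : Finset ι)

/-- `shapeHom` on a generator (ours, bookkeeping). [cite: Lang2002, Ch. IV §1] -/
theorem shapeHom_X (D : Data ι R) (x : ι) :
    shapeHom Zs Ws D (X x)
      = if x ∈ Zs then X x + C (D.c x) else if x ∈ Ws then X x + D.Λ x else X x + (∑ W ∈ Ws, C (D.m x W) * X W) + D.Θ x := by
  simp only [shapeHom, aeval_X]

/-- On polynomials in the `Z`-slots the shape substitution is the translation `τ_c` (ours; the reason for the composition law). [cite: Lang2002, Ch. IV §1] -/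
theorem shapeHom_of_overZ (D : Data ι R) {q : MvPolynomial ι R} (hq : OverZ Zs q) : shapeHom Zs Ws D q = ShapeGroup.transl Zs D.c q := by
  have key := MvPolynomial.hom_congr_vars (f₁ := (shapeHom Zs Ws D : MvPolynomial ι R →+* MvPolynomial ι R))
    (f₂ := (ShapeGroup.transl Zs D.c : MvPolynomial ι R →+* MvPolynomial ι R)) (p₁ := q) (p₂ := q)
    (by ext r; simp only [RingHom.comp_apply, RingHom.coe_coe, MvPolynomial.algHom_C, algebraMap_eq])
    (fun j hj _ => by rw [RingHom.coe_coe, RingHom.coe_coe, shapeHom_X, transl_X, if_pos (hq hj), if_pos (hq hj)]) rfl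
  simpa using key

/-- The zero data gives the identity (ours, bookkeeping). [cite: Lang2002, Ch. IV §1] -/
theorem shapeHom_zero : shapeHom Zs Ws (Data.zero : Data ι R) = AlgHom.id R (MvPolynomial ι R) := by
  refine MvPolynomial.algHom_ext fun x => ?_
  rw [shapeHom_X, AlgHom.id_apply]
  simp [Data.zero]

/-- **T97 (i): THE COMPOSITION LAW** (ours): for data `B` over `Z` and `Ws` disjoint from `Zs`,
`shapeHom A ∘ shapeHom B = shapeHom (A ∘ B)`. [cite: Lang2002, Ch. IV §1] -/
theorem shapeHom_comp (hdisj : ∀ W ∈ Ws, W ∉ Zs) (A B : Data ι R) (hB : B.IsOverZ Zs Ws) :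
    (shapeHom Zs Ws A).comp (shapeHom Zs Ws B) = shapeHom Zs Ws (A.comp Zs Ws B) := by
  refine MvPolynomial.algHom_ext fun x => ?_
  rw [AlgHom.comp_apply, shapeHom_X, shapeHom_X]
  by_cases hz : x ∈ Zs
  · rw [if_pos hz, if_pos hz, map_add, shapeHom_X, if_pos hz, MvPolynomial.algHom_C, algebraMap_eq]
    simp only [Data.comp, Pi.add_apply, C_add]
    ring
  · rw [if_neg hz, if_neg hz]
    by_cases hW : x ∈ Ws
    · rw [if_pos hW, if_pos hW, map_add, shapeHom_X, if_neg hz, if_pos hW, shapeHom_of_overZ Zs Ws A (hB.overΛ x hW)]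
      simp only [Data.comp]
      ring
    · rw [if_neg hW, if_neg hW, map_add, map_add, shapeHom_X, if_neg hz, if_neg hW, map_sum,
        shapeHom_of_overZ Zs Ws A (hB.overΘ x)]
      have hs : ∑ W ∈ Ws, shapeHom Zs Ws A (C (B.m x W) * X W) = ∑ W ∈ Ws, (C (B.m x W) * X W + C (B.m x W) * A.Λ W) := by
        refine Finset.sum_congr rfl fun W hW' => ?_
        rw [map_mul, MvPolynomial.algHom_C, algebraMap_eq, shapeHom_X, if_neg (hdisj W hW'), if_pos hW', mul_add]
      rw [hs, Finset.sum_add_distrib]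
      have hm : ∑ W ∈ Ws, C ((A.comp Zs Ws B).m x W) * X W = ∑ W ∈ Ws, C (A.m x W) * X W + ∑ W ∈ Ws, C (B.m x W) * X W := by
        rw [← Finset.sum_add_distrib]
        refine Finset.sum_congr rfl fun W _ => ?_
        simp only [Data.comp, Pi.add_apply, C_add]
        ring
      rw [hm]
      simp only [Data.comp]
      ring

/-- Composition keeps the data over `Z` (ours, bookkeeping). [cite: Lang2002, Ch. IV §1] -/
theorem Data.IsOverZ.comp {A B : Data ι R} (hA : A.IsOverZ Zs Ws) (hB : B.IsOverZ Zs Ws) : (A.comp Zs Ws B).IsOverZ Zs Ws where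
  overΛ W hW := (hA.overΛ W hW).add ((hB.overΛ W hW).transl _)
  overΘ x := ((hA.overΘ x).add ((hB.overΘ x).transl _)).add
    (OverZ.sum _ _ fun W hW => (overZ_C Zs _).mul (hA.overΛ W hW))

omit [DecidableEq ι] in
/-- The zero data is over `Z` (ours, bookkeeping). [cite: Lang2002, Ch. IV §1] -/
theorem Data.isOverZ_zero : (Data.zero : Data ι R).IsOverZ Zs Ws where
  overΛ _ _ := overZ_zero Zs
  overΘ _ := overZ_zero Zs

/-- Powers stay over `Z` (ours, bookkeeping). [cite: Lang2002, Ch. IV §1] -/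
theorem Data.IsOverZ.pow {D : Data ι R} (hD : D.IsOverZ Zs Ws) : ∀ n, (D.pow Zs Ws n).IsOverZ Zs Ws
  | 0 => Data.isOverZ_zero Zs Ws
  | n + 1 => hD.comp Zs Ws (Data.IsOverZ.pow hD n)

/-- Unfolding `D^{0}` (ours, bookkeeping). [cite: Lang2002, Ch. IV §1] -/
@[simp] theorem Data.pow_zero_eq (D : Data ι R) : D.pow Zs Ws 0 = Data.zero := rfl

/-- Unfolding `D^{n+1} = D ∘ D^{n}` (ours, bookkeeping). [cite: Lang2002, Ch. IV §1] -/
@[simp] theorem Data.pow_succ_eq (D : Data ι R) (n : ℕ) : D.pow Zs Ws (n + 1) = D.comp Zs Ws (D.pow Zs Ws n) := rfl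

/-- **Powers of a shape substitution** (ours): `(shapeHom D)^n = shapeHom (D^{n})` for data over `Z`. [cite: Lang2002, Ch. IV §1] -/
theorem shapeHom_pow (hdisj : ∀ W ∈ Ws, W ∉ Zs) {D : Data ι R} (hD : D.IsOverZ Zs Ws) :
    ∀ n : ℕ, (shapeHom Zs Ws D) ^ n = shapeHom Zs Ws (D.pow Zs Ws n)
  | 0 => by rw [pow_zero, Data.pow_zero_eq, shapeHom_zero]; rfl
  | n + 1 => by
    rw [pow_succ', shapeHom_pow hdisj hD n, Data.pow_succ_eq, AlgHom.End_toSemigroup_toMul_mul,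
      shapeHom_comp Zs Ws hdisj D _ (hD.pow Zs Ws n)]

/-- `c(D^{n}) = n • c` (ours). [cite: Lang2002, Ch. IV §1] -/
theorem Data.pow_c (D : Data ι R) : ∀ n, (D.pow Zs Ws n).c = n • D.c
  | 0 => by simp [Data.zero]
  | n + 1 => by
    rw [Data.pow_succ_eq, succ_nsmul']
    show D.c + (D.pow Zs Ws n).c = _
    rw [Data.pow_c D n]

/-- `m(D^{n}) = n • m` (ours). [cite: Lang2002, Ch. IV §1] -/
theorem Data.pow_m (D : Data ι R) : ∀ n, (D.pow Zs Ws n).m = n • D.m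
  | 0 => by simp [Data.zero]
  | n + 1 => by
    rw [Data.pow_succ_eq, succ_nsmul']
    show D.m + (D.pow Zs Ws n).m = _
    rw [Data.pow_m D n]

/-- **`Λ(D^{n}) = Σ_{i<n} τ_{i•c} Λ`** (ours; the engine's `Λtot_{X^m}(z) = Σ_{i<m} Λtot_X(z + iσ^s c)`). [cite: Lang2002, Ch. IV §1] -/
theorem Data.pow_Λ (D : Data ι R) (W : ι) :
    ∀ n, (D.pow Zs Ws n).Λ W = ∑ i ∈ Finset.range n, ShapeGroup.transl Zs (i • D.c) (D.Λ W)
  | 0 => by simp [Data.zero]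
  | n + 1 => by
    rw [Data.pow_succ_eq, Finset.sum_range_succ', zero_smul, transl_zero, AlgHom.id_apply]
    show D.Λ W + ShapeGroup.transl Zs D.c ((D.pow Zs Ws n).Λ W) = _
    rw [Data.pow_Λ D W n, map_sum, add_comm]
    refine congrArg (· + D.Λ W) (Finset.sum_congr rfl fun i _ => ?_)
    rw [transl_transl, succ_nsmul']

end Laws

/-! ## Smoke test -/

section Test

/-- `ι = Fin 3`: slot `0` is a `Z`-slot, slot `1` a `W`-slot, slot `2` an `f`-slot.  Data `D`: `c = 1` on `z`, `Λ_W = z²`, `m_{f,W} = 1`, `Θ_f = 0`.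
Then `D ∘ D` has `c = 2`, `Λ = z² + (z+1)²`, `m = 2`, and the cocycle `Θ_f = 0 + 0 + m_{f,W}·Λ_W = z²`. -/
example :
    (Data.comp ({0} : Finset (Fin 3)) ({1} : Finset (Fin 3))
        (⟨fun _ => 1, fun _ => X 0 ^ 2, fun _ _ => 1, fun _ => 0⟩ : Data (Fin 3) ℤ)
        ⟨fun _ => 1, fun _ => X 0 ^ 2, fun _ _ => 1, fun _ => 0⟩).Θ 2 = X 0 ^ 2 := by
  simp [Data.comp]

end Test

end ShapeGroup

end Literature.AlgebraicGeometry.Resolution.WeightedBlowup
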